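import Literature.Analysis.FluidPDE.ElgindiSolutionLimits
import HarnessLib

/-!
# Limits of solutions in `L¹_loc(strip)`
([Elgindi2021] §7.1 Proposition 7.1, §7.5 Theorem 2 — passage to the limit in the data)

Topic `Literature/Analysis/FluidPDE`. Proof file (everything proved, no definitions, no named
facts) on the proof path of the named fact
`Literature.Analysis.FluidPDE.Elgindi.ElgindiGhoulMasmoudi2021_stabilityCore`
(`ElgindiStabilityDecomposition.lean`). T. M. Elgindi, Ann. of Math. 194 (2021) =
arXiv:1904.04795, §7.1 (p. 19), §7.5 (p. 24).

The `L¹_loc` version of `ElgindiSolutionLimits.lean`: the distributional identity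
`∫∫u·ᵗLΦ = ∫∫f·Φ` passes to limits `u_n → u`, `f_n → f` in `L¹(K)` for every compact `K ⊆ strip`
(`integral_transposeOp_of_tendsto_loc`), whence limits of classical strip solutions have smooth
representatives solving the limit equation (`exists_smooth_limit_solution_loc`). (The Theorem 2
solutions contain `L₁₂(F) sin 2θ`, which is not square integrable in general, so `L²(strip)` limits
are not available; local `L¹` limits are.)
-/

noncomputable section

open MeasureTheory Set Function Real Filter
open _root_.Topology
open scoped ENNReal ContDiff

namespace Literature.Analysis.FluidPDE

namespace Elgindi

/-- **Pairings against a bounded compactly supported weight converge under `L¹(K)` convergence.** [folklore] -/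
theorem tendsto_integral_mul_of_L1loc {us : ℕ → ℝ × ℝ → ℝ} {u : ℝ × ℝ → ℝ} {g : ℝ × ℝ → ℝ}
    (hg : Continuous g) (hgs : HasCompactSupport g) (hgS : tsupport g ⊆ strip)
    (hus : ∀ n, LocallyIntegrableOn (us n) strip volume) (hu : LocallyIntegrableOn u strip volume)
    (hconv : ∀ K ⊆ strip, IsCompact K → Tendsto (fun n => ∫ p in K, |us n p - u p|) atTop (𝓝 0)) :
    Tendsto (fun n => ∫ p in strip, us n p * g p) atTop (𝓝 (∫ p in strip, u p * g p)) := by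
  set K := tsupport g with hK
  have hKc : IsCompact K := hgs
  obtain ⟨M, hM⟩ := hgs.exists_bound_of_continuous hg  -- `‖g x‖ ≤ M`
  have hM0 : 0 ≤ M := le_trans (norm_nonneg _) (hM 0)
  -- integrability on `K` and vanishing off `K`
  have hiK : ∀ {v : ℝ × ℝ → ℝ}, LocallyIntegrableOn v strip volume → IntegrableOn (fun p => v p * g p) K volume := by
    intro v hv
    have h1 : IntegrableOn v K volume := by
      rw [locallyIntegrableOn_iff isOpen_strip.isLocallyClosed] at hv
      exact hv K hgS hKc
    exact h1.mul_continuousOn hg.continuousOn hKc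
  have hzero : ∀ (v : ℝ × ℝ → ℝ), ∫ p in strip, v p * g p = ∫ p in K, v p * g p := by
    intro v
    rw [← integral_indicator measurableSet_strip, ← integral_indicator hKc.measurableSet]
    congr 1; funext p
    by_cases hp : p ∈ K
    · rw [indicator_of_mem hp, indicator_of_mem (hgS hp)]
    · rw [indicator_of_notMem hp]
      by_cases hp' : p ∈ strip
      · rw [indicator_of_mem hp', show g p = 0 from image_eq_zero_of_notMem_tsupport hp, mul_zero]
      · rw [indicator_of_notMem hp']
  simp_rw [hzero]
  rw [Metric.tendsto_atTop]
  intro ε hε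
  have hc := hconv K hgS hKc
  rw [Metric.tendsto_atTop] at hc
  obtain ⟨N, hN⟩ := hc (ε / (M + 1)) (by positivity)
  refine ⟨N, fun n hn => ?_⟩
  have h := hN n hn
  rw [Real.dist_eq, sub_zero, abs_of_nonneg (setIntegral_nonneg hKc.measurableSet fun p _ => abs_nonneg _)] at h
  rw [Real.dist_eq, ← integral_sub (hiK (hus n)) (hiK hu)]
  have hb : |∫ p in K, (us n p * g p - u p * g p)| ≤ M * ∫ p in K, |us n p - u p| := by
    have hi : IntegrableOn (fun p => |us n p - u p|) K volume := by
      have h1 : IntegrableOn (us n) K volume := by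
        have := hus n; rw [locallyIntegrableOn_iff isOpen_strip.isLocallyClosed] at this; exact this K hgS hKc
      have h2 : IntegrableOn u K volume := by
        have := hu; rw [locallyIntegrableOn_iff isOpen_strip.isLocallyClosed] at this; exact this K hgS hKc
      exact (h1.sub h2).abs
    have hle := norm_integral_le_of_norm_le (μ := volume.restrict K) (f := fun p : ℝ × ℝ => us n p * g p - u p * g p)
      (hi.const_mul M) (ae_of_all _ fun p => by
        rw [Real.norm_eq_abs, show us n p * g p - u p * g p = (us n p - u p) * g p by ring, abs_mul, mul_comm M]
        exact mul_le_mul_of_nonneg_left ((Real.norm_eq_abs _).symm.le.trans (hM p)) (abs_nonneg _))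
    rw [Real.norm_eq_abs, MeasureTheory.integral_const_mul] at hle
    exact hle
  calc |∫ p in K, (us n p * g p - u p * g p)| ≤ M * ∫ p in K, |us n p - u p| := hb
    _ ≤ M * (ε / (M + 1)) := mul_le_mul_of_nonneg_left h.le hM0
    _ < ε := by
        rw [mul_div_assoc']
        rw [div_lt_iff₀ (by positivity)]
        nlinarith

/-- **The distributional identity passes to `L¹_loc` limits.** [folklore] -/
theorem integral_transposeOp_of_tendsto_loc {α : ℝ} {Φ : ℝ → ℝ → ℝ} (hΦn : ∀ n : ℕ, ContDiff ℝ n (uncurry Φ))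
    (hΦs : HasCompactSupport (uncurry Φ)) (hΦS : tsupport (uncurry Φ) ⊆ strip)
    {us fs : ℕ → ℝ × ℝ → ℝ} {u f : ℝ × ℝ → ℝ}
    (hus : ∀ n, LocallyIntegrableOn (us n) strip volume) (hu : LocallyIntegrableOn u strip volume)
    (hfs : ∀ n, LocallyIntegrableOn (fs n) strip volume) (hf : LocallyIntegrableOn f strip volume)
    (hcu : ∀ K ⊆ strip, IsCompact K → Tendsto (fun n => ∫ p in K, |us n p - u p|) atTop (𝓝 0))
    (hcf : ∀ K ⊆ strip, IsCompact K → Tendsto (fun n => ∫ p in K, |fs n p - f p|) atTop (𝓝 0))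
    (hid : ∀ n, ∫ p in strip, us n p * transposeOp α Φ p = ∫ p in strip, fs n p * Φ p.1 p.2) :
    ∫ p in strip, u p * transposeOp α Φ p = ∫ p in strip, f p * Φ p.1 p.2 := by
  have hT := continuous_transposeOp α hΦn hΦS
  have hTs := hasCompactSupport_transposeOp α hΦs
  have hTS : tsupport (transposeOp α Φ) ⊆ strip := by
    refine (closure_minimal (fun p hp => ?_) (isClosed_tsupport (uncurry Φ))).trans hΦS
    by_contra h; exact hp (transposeOp_eq_zero_of_notMem α h)
  have h1 := tendsto_integral_mul_of_L1loc hT hTs hTS hus hu hcu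
  have h2 := tendsto_integral_mul_of_L1loc (g := fun p : ℝ × ℝ => Φ p.1 p.2) (hΦn 0).continuous hΦs hΦS hfs hf hcf
  have he : (fun n => ∫ p in strip, us n p * transposeOp α Φ p) = fun n => ∫ p in strip, fs n p * Φ p.1 p.2 := funext hid
  rw [he] at h1
  exact tendsto_nhds_unique h1 h2

/-- **Limits of classical solutions, `L¹_loc` form**: if `Ψ_n ∈ C^∞(strip)` solve `LΨ_n = F_n` on the
strip, `Ψ_n → u` and `F_n → F` in `L¹(K)` for all compact `K ⊆ strip`, `u ∈ L¹_loc(strip)` and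
`F ∈ C^∞(strip)`, then `u` has a smooth representative `Ψ` with `LΨ = F` on the strip. [cite: Elgindi2021, §7.1 Proposition 7.1 and §7.5 (pp. 19, 24 of arXiv:1904.04795)] -/
theorem exists_smooth_limit_solution_loc {α : ℝ} (hα : 0 < α) {Ψs Fs : ℕ → ℝ × ℝ → ℝ} (hΨs : ∀ n, ContDiffOn ℝ ∞ (Ψs n) strip)
    (hFs : ∀ n, ContDiffOn ℝ ∞ (Fs n) strip)
    (heq : ∀ n, ∀ p ∈ strip, ellipticOp α (fun R θ => Ψs n (R, θ)) p.1 p.2 = Fs n p)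
    {u : ℝ × ℝ → ℝ} (hu : LocallyIntegrableOn u strip volume)
    {F : ℝ × ℝ → ℝ} (hF : ContDiffOn ℝ ∞ F strip)
    (hcu : ∀ K ⊆ strip, IsCompact K → Tendsto (fun n => ∫ p in K, |Ψs n p - u p|) atTop (𝓝 0))
    (hcf : ∀ K ⊆ strip, IsCompact K → Tendsto (fun n => ∫ p in K, |Fs n p - F p|) atTop (𝓝 0)) :
    ∃ Ψ : ℝ × ℝ → ℝ, ContDiffOn ℝ ∞ Ψ strip ∧ (∀ᵐ y ∂(volume : Measure (ℝ × ℝ)), y ∈ strip → u y = Ψ y) ∧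
      ∀ p ∈ strip, ellipticOp α (fun R θ => Ψ (R, θ)) p.1 p.2 = F p := by
  have hl : ∀ {v : ℝ × ℝ → ℝ}, ContDiffOn ℝ ∞ v strip → LocallyIntegrableOn v strip volume :=
    fun hv => hv.continuousOn.locallyIntegrableOn measurableSet_strip
  have hsol : ∀ Φ : ℝ → ℝ → ℝ, (∀ n : ℕ, ContDiff ℝ n (uncurry Φ)) → HasCompactSupport (uncurry Φ) → tsupport (uncurry Φ) ⊆ strip →
      ∫ p in strip, u p * transposeOp α Φ p = ∫ p in strip, F p * Φ p.1 p.2 := fun Φ hΦn hΦs hΦS =>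
    integral_transposeOp_of_tendsto_loc hΦn hΦs hΦS (fun n => hl (hΨs n)) hu (fun n => hl (hFs n)) (hl hF) hcu hcf
      fun n => integral_classical_transposeOp (hΨs n) (heq n) hΦn hΦs hΦS
  obtain ⟨Ψ, hΨ, hae⟩ := exists_smooth_rep_of_distrib hα hF hu hsol
  exact ⟨Ψ, hΨ, hae, ellipticOp_rep_of_distrib hF hsol hΨ hae⟩

end Elgindi

end Literature.Analysis.FluidPDE
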